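import Literature.AlgebraicGeometry.Resolution.RsopMonomialIdeals
import HarnessLib

/-!
# Crux `PatchingRelPerfect` (stmt-ResolutionOfSingularities-16161), chain W5.2 — T6-E1b residual `LegalScopedDivisorReduction₃`,
# PHASE 2 closer (2b), spec D4 sub-lemma L3: GENERATOR EXCHANGE IN A TWO-PARAMETER IDEAL

[OURS · L1 W5.2 · res-L1-w52-lead-1 g5, hand #3b; spec `L/res-L1-w52-lead-1/PHASE2-STEPB-SPEC.md` §D4 ORACLE PLAN, step (i), L3]
Replaces the role of NO printed item; NOT a statement of the manuscript under review; fact-free, pure commutative algebra.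

In a local ring, let `I = (w₀, w₁)` with `w` part of a regular system of parameters (the ideal of a regular curve `Γ` in a regular
threefold germ), `f ∈ I ∖ 𝔪²` (the equation of a regular member `F₁ ⊇ Γ`) and `g ∈ I ∖ ((f) + 𝔪²)`.  Writing `f = a w₀ + b w₁`,
`g = c w₀ + d w₁`, the determinant `a d − b c` is a unit (otherwise `g ∈ (f) + 𝔪²`), and Cramer's rule gives `w₀, w₁ ∈ (f, g)`:
`I = (f) + (g)`.  This is the input `hC` of (GEN) `DepthSNC.SNCWithAt.centre_of_members_sup_span` with `A = {F₁}` in the cases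
(a)/(c) of the curve-choosing oracle.

AI-written; AI review is weaker than expert review.

## References
* H. Matsumura, *Commutative Ring Theory* (1986), Thm. 14.2, Thm. 2.2 (Nakayama). [Matsumura1987]
-/

-- `Summit.<Summit>.<Sub>.Theorems` with `Sub = Summit` (single-conjunct summit, D-0017)
set_option linter.dupNamespace false

noncomputable section

open IsLocalRing Literature.AlgebraicGeometry.Resolution

namespace Summit.ResolutionOfSingularities.ResolutionOfSingularities.Theorems

universe u

namespace DepthLegal

/-- The values of a pair. [folklore] -/
theorem range_fin_two {R : Type u} (w : Fin 2 → R) : Set.range w = {w 0, w 1} := by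
  ext a
  simp only [Set.mem_range, Fin.exists_fin_two, Set.mem_insert_iff, Set.mem_singleton_iff, eq_comm]

/-- [OURS · L1 W5.2] **L3 — generator exchange in a two-parameter ideal**: for `w : Fin 2 → R` part of a regular system of
parameters, `f ∈ (w) ∖ 𝔪²` and `g ∈ (w) ∖ ((f) + 𝔪²)`, one has `(f) + (g) = (w)` (module docstring). [cite: Matsumura1987, Thm. 14.2] -/
theorem span_sup_span_eq_of_isRsopPart {R : Type u} [CommRing R] [IsLocalRing R] {w : Fin 2 → R} (hw : IsRsopPart w) {f g : R}
    (hf : f ∈ Ideal.span (Set.range w)) (hg : g ∈ Ideal.span (Set.range w)) (hf2 : f ∉ maximalIdeal R ^ 2)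
    (hgf : g ∉ Ideal.span {f} ⊔ maximalIdeal R ^ 2) :
    Ideal.span {f} ⊔ Ideal.span {g} = Ideal.span (Set.range w) := by
  have hw0 : w 0 ∈ maximalIdeal R := hw.mem_maximalIdeal 0
  have hw1 : w 1 ∈ maximalIdeal R := hw.mem_maximalIdeal 1
  rw [range_fin_two] at hf hg ⊢
  obtain ⟨a, b, hab⟩ := Ideal.mem_span_pair.mp hf
  obtain ⟨c, d, hcd⟩ := Ideal.mem_span_pair.mp hg
  -- products of two elements of `𝔪` lie in `𝔪²`
  have hsq : ∀ {p q : R}, p ∈ maximalIdeal R → q ∈ maximalIdeal R → p * q ∈ maximalIdeal R ^ 2 :=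
    fun hp hq => by rw [pow_two]; exact Ideal.mul_mem_mul hp hq
  -- `g - t f ∈ 𝔪²` contradicts `hgf`
  have key : ∀ t r : R, g - t * f = r → r ∈ maximalIdeal R ^ 2 → False := by
    intro t r h hr
    apply hgf
    have : g = t * f + r := by rw [← h]; ring
    rw [this]
    exact Submodule.add_mem_sup (Ideal.mul_mem_left _ _ (Ideal.mem_span_singleton_self f)) hr
  -- the determinant is a unit
  have hD : IsUnit (a * d - b * c) := by
    by_contra hD
    have hDm : a * d - b * c ∈ maximalIdeal R := (mem_maximalIdeal _).mpr hD
    by_cases ha : IsUnit a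
    · obtain ⟨a', ha'⟩ := ha.exists_left_inv
      refine key (c * a') (a' * (a * d - b * c) * w 1) ?_ (hsq (Ideal.mul_mem_left _ _ hDm) hw1)
      rw [← hcd, ← hab]
      linear_combination (-(c * w 0 + d * w 1)) * ha'
    · by_cases hb : IsUnit b
      · obtain ⟨b', hb'⟩ := hb.exists_left_inv
        refine key (d * b') (-(b' * (a * d - b * c) * w 0)) ?_ ?_
        · rw [← hcd, ← hab]
          linear_combination (-(c * w 0 + d * w 1)) * hb'
        · exact neg_mem_iff.mpr (hsq (Ideal.mul_mem_left _ _ hDm) hw0)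
      · -- `a, b ∈ 𝔪` forces `f ∈ 𝔪²`
        exact hf2 (hab ▸ Ideal.add_mem _ (hsq ((mem_maximalIdeal _).mpr ha) hw0) (hsq ((mem_maximalIdeal _).mpr hb) hw1))
  -- Cramer: `D w₀ = d f - b g`, `D w₁ = a g - c f`
  obtain ⟨D', hD'⟩ := hD.exists_left_inv
  apply le_antisymm
  · exact sup_le ((Ideal.span_singleton_le_iff_mem _).mpr hf) ((Ideal.span_singleton_le_iff_mem _).mpr hg)
  · have hfI : f ∈ Ideal.span {f} ⊔ Ideal.span {g} := Ideal.mem_sup_left (Ideal.mem_span_singleton_self f)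
    have hgI : g ∈ Ideal.span {f} ⊔ Ideal.span {g} := Ideal.mem_sup_right (Ideal.mem_span_singleton_self g)
    have h0 : w 0 = D' * (d * f - b * g) := by
      rw [← hab, ← hcd]; linear_combination (-(w 0)) * hD'
    have h1 : w 1 = D' * (a * g - c * f) := by
      rw [← hab, ← hcd]; linear_combination (-(w 1)) * hD'
    rw [Ideal.span_le]
    rintro _ (rfl | rfl)
    · rw [SetLike.mem_coe, h0]
      exact Ideal.mul_mem_left _ _ (Ideal.sub_mem _ (Ideal.mul_mem_left _ _ hfI) (Ideal.mul_mem_left _ _ hgI))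
    · rw [SetLike.mem_coe, h1]
      exact Ideal.mul_mem_left _ _ (Ideal.sub_mem _ (Ideal.mul_mem_left _ _ hgI) (Ideal.mul_mem_left _ _ hfI))

end DepthLegal

end Summit.ResolutionOfSingularities.ResolutionOfSingularities.Theorems
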